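import Summits.ResolutionOfSingularities.ResolutionOfSingularities.Theorems.MarkedTransferCampaignW12SandwichAntitoneObstruction
import Literature.AlgebraicGeometry.Hironaka2017.Lib.SInclCalculus
import Literature.AlgebraicGeometry.Hironaka2017.Proofs.S03DiffARNE.Rem3p16
import HarnessLib

/-!
# [OURS · L1 G1 ℘nega-INTERFACE · obstruction kernel, PART 2] The sandwich antitone obstruction AT THE CARRIERS OF RECORD:
# stalks `℘(E,j)_ξ = (S04CharAlgebra.pAlg E j)_ξ` at a singular point `ξ ∈ Sing(E)` of an ambient datum

LADDER-RESOLUTION rung L (rescue), cell `res-hironaka`, group G1 (`℘nega`). D-lane draft by res-D-pv-040 (HOME/D/res-D-pv-040/),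
sibling of `MarkedTransferCampaignW12SandwichAntitoneObstruction.lean` (PART 1: the ring-level obstruction `W12.sandwichPNega_not_le_of_isLocalRing`
under the order condition `℘(E,k) ⊆ 𝔪^k`). Here the order condition is DISCHARGED at the campaign's carriers: for an ambient datum `A`
over a field `K` of characteristic `p` (row 001 `AmbientDatum`, §2 p.4 l.22–24), ANY ideal exponent `E` on `A.Z` and ANY `ξ ∈ Sing(E)`,
`℘(E,k)_ξ ⊆ 𝔪_ξ^k` (`stalkIdeal_pAlg_le_maximalIdeal_pow`: `𝔖(℘(E,k),k) ⊃ 𝔖(E)` by the tree's `sIncl_pAlg`, hence `Sing(E) ⊆ Sing(℘(E,k),k)`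
by `S03DiffARNE.sing_subset_sing_of_sIncl` — the pointwise form of `S09LLUED.U57_1_pAlg_ambientDatum` p479723). CONSEQUENCE
(`sandwichPNega_pAlgStalk_not_le`, `sandwichPNegaRho_negPiece_pAlgStalk_not_subset`): for EVERY level `e` and EVERY `m ≥ 1` with
`℘(E,m)_ξ ≠ 0`, the W1.2 sandwich on the stalks `P j := ℘(E,j)_ξ`, its module variant SWρ and the power witness PW are NOT antitone
below zero, and the typed Lem 5.9 (1) READ AT BASE `ρ^e(𝒪_{Z,ξ})` fails there. NO new definition; the instance binder
`[CharP 𝒪_{Z,ξ} p]` is the lane's «I:CharP stalks» scope binder (dischargeable: `charP_stalk_ambient`).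

CARRIER NOTE (res-L1-type-o2 g6): KERNEL by res-D-pv-040 (HOME draft `D/res-D-pv-040/PnegaSandwichStalkObstruction.draft.lean` sha16 742905f1890bce23, DELIVERED #4 2026-08-27T04:18:55Z), carried summit-side VERBATIM (this note added) as the sibling of `…W12SandwichAntitoneObstruction.lean` p494935. [OURS · L1 G1] replaces the role of: nothing printed — a scoring kernel; NOT a statement of the manuscript.
HONEST FRAMING. Nothing here is a statement of H. Hironaka's manuscript *Resolution of singularities in positive characteristics*
(2017-03-23, [Hironaka2017], lit key `paper:url-3343fd9e678b`); `℘`, `Sing`, Def 5.1 and Lem 5.9 enter as typed carriers / SHAPES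
re-based on `ρ^e(O)` (OURS rescue candidates), CANDIDATES [claim: Hironaka2017, status: under-review]. AI typing/proving is weaker
than expert review; nothing here is progress on resolution of singularities in positive characteristic; no claim beyond the kernel.
-/

noncomputable section

set_option linter.dupNamespace false -- mandated namespace of this single-conjunct summit

namespace Summit.ResolutionOfSingularities.ResolutionOfSingularities.Theorems.Campaign.W12

open Literature.AlgebraicGeometry.Resolution
open Literature.AlgebraicGeometry.Hironaka2017
open Summit.ResolutionOfSingularities.ResolutionOfSingularities.Theorems.Campaign

variable (p : ℕ) [Fact p.Prime]

/-! ## The stalk placements of record -/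

section Stalk

open AlgebraicGeometry Literature.AlgebraicGeometry.Hironaka2017.S02Preliminaries
  Literature.AlgebraicGeometry.Hironaka2017.S04CharAlgebra Literature.AlgebraicGeometry.Hironaka2017.Datum
  Literature.AlgebraicGeometry.Hironaka2017.S03DiffARNE

universe u

variable {K : Type u} [Field K] [CharP K p]

omit [Fact p.Prime] in
/-- Stalks of an ambient datum have characteristic `p` (`K → Γ(Z,𝒪) → 𝒪_{Z,ξ}` is injective). Same argument as
`S16Proof.charP_stalk` (Proofs/S16Proof/Lem16p11), restated to keep this file's imports light. [folklore] -/
theorem charP_stalk_ambient [Fact p.Prime] (A : AmbientDatum p K) (ξ : A.Z) : CharP (A.Z.presheaf.stalk ξ) p := by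
  let φ : K →+* (A.Z.presheaf.stalk ξ : CommRingCat.{u}) :=
    (A.Z.presheaf.germ ⊤ ξ trivial).hom.comp (A.hom.appTop.hom.comp (Scheme.ΓSpecIso (.of K)).inv.hom)
  exact charP_of_injective_ringHom φ.injective p

/-- **The ORDER CONDITION at a singular point of an ambient datum:** `℘(E,k)_ξ ⊆ 𝔪_ξ^k` for every `k ≥ 1` and every
`ξ ∈ Sing(E)` — `𝔖(℘(E,k),k) ⊃ 𝔖(E)` (tree `sIncl_pAlg`) gives `Sing(E) ⊆ Sing(℘(E,k),k)` (tree `sing_subset_sing_of_sIncl`), i.e.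
`ord_ξ ℘(E,k) ≥ k` (the route of `S09LLUED.U57_1_pAlg_ambientDatum` p479723, pointwise). [folklore] -/
theorem stalkIdeal_pAlg_le_maximalIdeal_pow (A : AmbientDatum p K) (E : IdealExponent A.Z) {ξ : A.Z} (hξ : ξ ∈ E.sing)
    (k : ℕ) (hk : 0 < k) :
    stalkIdeal (pAlg E k) ξ ≤ IsLocalRing.maximalIdeal (A.Z.presheaf.stalk ξ) ^ k := by
  haveI := A.smooth
  haveI : IsLocallyNoetherian A.Z := LocallyOfFiniteType.isLocallyNoetherian A.hom
  have hZ : Scheme.IsRegular A.Z := Scheme.IsRegular.of_smooth A.hom (Scheme.isRegular_Spec (.of K))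
  have hsing : E.sing ⊆ (⟨pAlg E k, k⟩ : IdealExponent A.Z).sing :=
    sing_subset_sing_of_sIncl A E ⟨pAlg E k, k⟩ (sIncl_pAlg hZ E hk.ne')
  exact (le_idealOrder_iff (pAlg E k) ξ k).mp (hsing hξ)

/-- **OBSTRUCTION AT THE CARRIERS OF RECORD.** For an ambient datum `A` over a field `K` of characteristic `p`, ANY ideal exponent
`E` on `A.Z`, ANY point `ξ ∈ Sing(E)`, ANY level `e` and ANY `m ≥ 1` with `℘(E,m)_ξ ≠ 0`: the W1.2 sandwich built on the stalks
`P j := ℘(E,j)_ξ` is NOT antitone below zero — `℘nega_sw(E,−m)_ξ ⊄ ℘nega_sw(E,−b)_ξ` for some `b > m`; the typed Lem 5.9 (1) READ AT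
BASE `ρ^e(𝒪_{Z,ξ})` fails; the literal `antitone_nonpos` shape fails. (`𝒪_{Z,ξ}` Noetherian local: `A.Z` smooth over `K`; order
condition: `stalkIdeal_pAlg_le_maximalIdeal_pow`; Krull from Mathlib.) The instance binder `[CharP (𝒪_{Z,ξ}) p]` is the lane's
«I:CharP stalks» scope binder, dischargeable by `charP_stalk_ambient`. [folklore] -/
theorem sandwichPNega_pAlgStalk_not_le (A : AmbientDatum p K) (E : IdealExponent A.Z) {ξ : A.Z} (hξ : ξ ∈ E.sing)
    [CharP (A.Z.presheaf.stalk ξ) p] (e : ℕ) {m : ℕ} (hm : 0 < m) (hPm : stalkIdeal (pAlg E m) ξ ≠ ⊥) :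
    (¬ ∀ b : ℕ, m < b →
        sandwichPNega p e (fun j => stalkIdeal (pAlg E j) ξ) m m ≤ sandwichPNega p e (fun j => stalkIdeal (pAlg E j) ξ) m b) ∧
      ¬ S05NegativePart.Lem5_9_1 (↥(iterateFrobenius (A.Z.presheaf.stalk ξ) p e).range)
          (fun j => stalkIdeal (pAlg E j) ξ) m ∧
      ¬ ∀ i j : ℤ, i ≤ j → j ≤ 0 →
        sandwichPTildeNeg p e (fun j => stalkIdeal (pAlg E j) ξ) m (-j) ≤
          sandwichPTildeNeg p e (fun j => stalkIdeal (pAlg E j) ξ) m (-i) := by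
  haveI := A.smooth
  haveI : IsLocallyNoetherian A.Z := LocallyOfFiniteType.isLocallyNoetherian A.hom
  exact sandwichPNega_not_le_of_isLocalRing p e (fun k hk => stalkIdeal_pAlg_le_maximalIdeal_pow p A E hξ k hk) hm hPm

/-- **The same for SWρ (as sets) and for the power witness PW** (stalks of a smooth `K`-scheme are reduced). [folklore] -/
theorem sandwichPNegaRho_negPiece_pAlgStalk_not_subset (A : AmbientDatum p K) (E : IdealExponent A.Z) {ξ : A.Z}
    (hξ : ξ ∈ E.sing) [CharP (A.Z.presheaf.stalk ξ) p] (e : ℕ) {m : ℕ} (hm : 0 < m) (hPm : stalkIdeal (pAlg E m) ξ ≠ ⊥) :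
    (¬ ∀ b : ℕ, m < b →
        (sandwichPNegaRho p e (fun j => stalkIdeal (pAlg E j) ξ) m m : Set (A.Z.presheaf.stalk ξ)) ⊆
          (sandwichPNegaRho p e (fun j => stalkIdeal (pAlg E j) ξ) m b : Set (A.Z.presheaf.stalk ξ))) ∧
      ¬ ∀ b : ℕ, m < b →
        PowerWitness.negPiece p e (fun j => stalkIdeal (pAlg E j) ξ) m m ≤
          PowerWitness.negPiece p e (fun j => stalkIdeal (pAlg E j) ξ) m b := by
  haveI := A.smooth
  haveI : IsLocallyNoetherian A.Z := LocallyOfFiniteType.isLocallyNoetherian A.hom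
  have hZ : Scheme.IsRegular A.Z := Scheme.IsRegular.of_smooth A.hom (Scheme.isRegular_Spec (.of K))
  haveI : IsRegularLocalRing (A.Z.presheaf.stalk ξ) := hZ ξ
  haveI : IsDomain (A.Z.presheaf.stalk ξ) := isDomain_of_isRegularLocalRing _
  exact sandwichPNegaRho_negPiece_not_subset_of_isLocalRing p e
    (fun k hk => stalkIdeal_pAlg_le_maximalIdeal_pow p A E hξ k hk) hm hPm

end Stalk

end Summit.ResolutionOfSingularities.ResolutionOfSingularities.Theorems.Campaign.W12

end
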